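import Summits.ABC.ABC.Theses.DefiniteXi
import Literature.NumberTheory.EllipticCurves.DegreeConjectureAbc
import Literature.NumberTheory.EllipticCurves.SilvermanHeightCovolumeProofs
import HarnessLib

/-!
# Route DefiniteXi — support item `DegreeBoundToABCOfPetersson` (stmt-ABC-11342)

The frame `X → ABC` of route `ABC/DefiniteXi`, relative to the Petersson lower bound:

> `PeterssonLowerBound → FreyDegreeBound → ABC`.

Here `PeterssonLowerBound` is verbatim the named fact
`Literature.NumberTheory.EllipticCurves.ModularForms.murty_petersson_newform_lower_bound`
(`‖f_E‖² ≫_ε N^{1−ε}`, Hoffstein–Lockhart 1994 / Murty 1999), `FreyDegreeBound` is Frey's degree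
conjecture on Frey–Hellegouarch curves (`deg φ ≤ C_ε N^{2+ε}`), and `ABC` is the summit statement
(`:= Literature.Abc.ABCConjecture`, the strict/positive-constant form of Bombieri–Gubler 12.2.2).

The mathematics (Frey 1989; Mai–Murty 1994; M. R. Murty 1999, Thm. 1, direction "degree conjecture
⟹ abc"; Pasten arXiv:1705.09251 §3 Rem. 3.3) is entirely in the tree:
`Literature.NumberTheory.EllipticCurves.abcLt_of_freyDegreeBound` takes the Petersson bound,
Silverman's covolume inequality and the degree bound to the body of `ABC`, and Silverman's
inequality is PROVED (`silverman1986_discriminant_c4_covolume_holds`). So the item is the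
one-liner recorded in the route file; this theorem is unconditional (its only non-proved input,
the Petersson bound, is a hypothesis of the registered signature, filed as item stmt-ABC-10870).

## References

* M. R. Murty, *Bounds for congruence primes*, Proc. Sympos. Pure Math. 66.1 (1999), Thm. 1.
  [MurtyCongruencePrimes1999]
* H. Pasten, *Shimura curves and the abc conjecture*, arXiv:1705.09251, §3 Rem. 3.3.
  [PastenShimura2024]
* J. H. Silverman, *Heights and elliptic curves*, in: Arithmetic Geometry (1986), Cor. 2.3.
  [Silverman1986]
-/

-- `Summit.<Summit>.<Problem>` is the mandated summit-side namespace (CONVENTIONS §2); for the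
-- single-conjunct summit `ABC` the two coincide, so the duplicate `ABC.ABC` is deliberate.
set_option linter.dupNamespace false

namespace Summit.ABC.ABC.Theorems

/-- **Item stmt-ABC-11342 (`DegreeBoundToABCOfPetersson`), proved.** The Petersson lower bound
`‖f_E‖² ≫_ε N^{1−ε}` and Frey's degree conjecture `deg φ_{E_(a,b)} ≤ C_ε N^{2+ε}` on
Frey–Hellegouarch curves together imply the abc conjecture (`ABC`). Proof: the tree theorem
`abcLt_of_freyDegreeBound` (Zagier's identity `4π²c²(f,f) = deg · covol Λ`, Silverman's covolume
inequality — discharged by `silverman1986_discriminant_c4_covolume_holds` — and `rad ∣ 2N`),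
whose hypotheses are definitionally `PeterssonLowerBound` and `FreyDegreeBound` and whose
conclusion is definitionally `ABC`. [cite: MurtyCongruencePrimes1999, Thm. 1] -/
theorem degreeBoundToABCOfPetersson_proof :
    Summit.ABC.ABC.Theses.DefiniteXi.DegreeBoundToABCOfPetersson := by
  unfold Summit.ABC.ABC.Theses.DefiniteXi.DegreeBoundToABCOfPetersson
  intro hP hdeg
  exact Literature.NumberTheory.EllipticCurves.abcLt_of_freyDegreeBound hP
    Literature.NumberTheory.EllipticCurves.ModularForms.silverman1986_discriminant_c4_covolume_holds
    hdeg

end Summit.ABC.ABC.Theorems
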